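import Summits.HodgeConjecture.HodgeConjecture.Theorems.Ring2WeilCoverageCMFieldCarrierInstancesCyclotomic24
import HarnessLib

/-!
# Ring 2 — Weil-type family-coverage census, CM-field rows (X-BA): the quartic CM subfields of the atlas
# cyclotomic field(s) `ℚ(ζ₆₀)` OUTSIDE the seven census tables —
# `ℚ(i,√15)`, `ℚ(√-5,√3)`, `ℚ(√-3,√-5)`, `ℚ(√-3(5+√5)/2)` —
# their carriers, and on EVERY row `W8.E.δ` of their tables a CM eightfold with HC in the kernel

HONEST FRAMING: research route conditional on HC_CM; not a corollary; Q11.4-sentence-2 already refuted in dim ≥ 3.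

Cell `pub-hodge-ring2`, seat `ring2-b03` (gen 64), census `WEIL-FAMILY-COVERAGE.md` «## b03», open cells (viii′)/(xii′) of b03.19/b03.20
(«the non-census quartic CM subfields of `ℚ(ζ₂₄)`, `ℚ(ζ₄₀)`, `ℚ(ζ₆₀)`»): the cyclic-cover (`ℤ/m`-Prym) eightfolds of the atlas with
`m ∈ {24, 40, 48, 60}` carry, besides the census fields, Weil-type `(2,2;2,2)` structures for FOURTEEN further quartic CM
fields `K' ⊂ ℚ(ζ_m)` (eleven biquadratic, three cyclic of conductors `40`, `48`, `60`); this part treats the four new subfields of `ℚ(ζ₆₀)`: `ℚ(i,√15)`, `ℚ(√-5,√3)`, `ℚ(√-3,√-5)` and the cyclic field `ℚ(√-3(5+√5)/2)` of conductor `60` (the twist of `ℚ(ζ₅)` by `√3`).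
Exactly as parts X-L / X-M (`Ring2WeilCoverageCMFieldCarrierInstances{,Biquadratic}`, which rest on part X-K): for each carrier
`R = S² + pS + q` — `E = cmField R = ℚ(η)`, `η⁴ + pη² + q = 0` — the twist `η'` with `η'² + η² + p = 0` (so `E/ℚ` is Galois),
for a biquadratic field a square root `i ∈ E` of `-c` (so `ℚ(√-c) ⊂ E`; member `B⁴`, `B ~ C₁²` of the CM type induced from
`ℚ(√-c)`, HC by Hazama / Pohlmann in the kernel), for a cyclic field the order-`4` substitution `u` with `u(η) = η'`,
`u(η') = -η` (member `B⁴`, `B` a SIMPLE CM surface, HC by Pohlmann in the kernel); all checked by `linear_combination`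
against `η⁴ + pη² + q = 0`:

| field `E` | carrier `(p,q)` | `η'` | `c` / `u` | `i`, `i² = -c` |
|---|---|---|---|---|
| `ℚ(i,√15)` (η = i(1+√15)) | `(32,196)` | `-(η³ + 32η)/14` | `1` | `-(η³ + 18η)/28` |
| `ℚ(√-5,√3)` (η = √-5(1+√3)) | `(40,100)` | `-(η³ + 40η)/10` | `5` | `-(η³ + 30η)/20` |
| `ℚ(√-3,√-5)` (η = √-3 + √-5) | `(16,4)` | `-(η³ + 16η)/2` | `3` | `-(η³ + 14η)/4` |
| `ℚ(√-3(5+√5)/2)` (η² = -3(5+√5)/2 = 3(ζ₅ - ζ₅⁻¹)²; cyclic, conductor 60) | `(15,45)` | `(η³ + 9η)/3` | `u = (T³ + 9T)/3` | — |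

THEOREMS ONLY: no `def`, no named fact, no `sorry`; `HC_CM` does not occur. HONEST COLUMN: named CM members only;
nothing at the general member of any row (crux stmt-1076); the sign of `δ` is not recorded by `IsPolarizationClass`.

## References
* [Deligne1982HodgeCycles] P. Deligne (notes by J. S. Milne), *Hodge cycles on abelian varieties*, LNM 900 (1982), §4, §5 (c).
* [Gordon1999HodgeAVSurvey] B. Gordon, Appendix B to Lewis, *A survey of the Hodge conjecture* (1999), Thm. 6.4 (Hazama).
* [Pohlmann1968] H. Pohlmann, Ann. of Math. 88 (1968), Thm. 1. [Shimura1998] G. Shimura, *Abelian Varieties with Complex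
  Multiplication and Modular Functions* (1998), §8 Ex. 8.4 (2).
-/

noncomputable section

set_option linter.dupNamespace false

namespace Summit.HodgeConjecture.HodgeConjecture.Ring2.WeilCoverageCM

open CategoryTheory CategoryTheory.Limits Polynomial NumberField
open Literature.AlgebraicGeometry Literature.AlgebraicGeometry.Motives Literature.AlgebraicGeometry.HodgeTheory
open Literature.AlgebraicGeometry.ComplexMultiplication Literature.AlgebraicGeometry.Deligne1982
open Literature.AlgebraicGeometry.Milne1999
open Summit.HodgeConjecture.HodgeConjecture.Ring2.Hypotheses (RosatiCompatible)

/-! ## §1 `ℚ(i,√15)`: `R = S² + 32S + 196` (`η = i(1+√15)`), biquadratic, `ℚ(i) ⊂ E` -/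

section SqrtNeg1Sqrt15

variable {R : Polynomial ℤ}

/-- The `Fact` for `E = ℚ(i,√15) = ℚ[T]/(T⁴ + 32T² + 196)` (discriminant `240 = 15·4²`). [folklore] -/
theorem sqrtNeg1Sqrt15_fact_cmPolyQ (hR : R = X ^ 2 + C 32 * X + C 196) : Fact (Irreducible (cmPolyQ R)) :=
  fact_irreducible_cmPolyQ_of_pos hR (by norm_num) (by norm_num)
    (not_sq_of_eq_nonsquare_mul_sq (n := 15) (not_isSquare_of_sq_lt_of_lt_sq (k := 3) (by norm_num) (by norm_num)) (m := 4)
      (by norm_num) (by norm_num))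

/-- In `ℚ(i,√15)`: `η' = -(η³ + 32η)/14 = 14η⁻¹` satisfies `η'² + η² + 32 = 0`. [folklore] -/
theorem sqrtNeg1Sqrt15_twist_sq (hR : R = X ^ 2 + C 32 * X + C 196) [Fact (Irreducible (cmPolyQ R))] :
    (-(cmRoot R ^ 3 + 32 * cmRoot R) / 14) ^ 2 + cmRoot R ^ 2 + ((32 : ℤ) : cmField R) = 0 := by
  have ht := cmRoot_quartic R hR
  push_cast at ht ⊢
  linear_combination (cmRoot R ^ 2 / 196 + 8 / 49) * ht

/-- In `ℚ(i,√15)`: `i = -(η³ + 18η)/28` satisfies `i² + 1 = 0`. [folklore] -/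
theorem sqrtNeg1Sqrt15_sqrtNegOne_sq (hR : R = X ^ 2 + C 32 * X + C 196) [Fact (Irreducible (cmPolyQ R))] :
    (-(cmRoot R ^ 3 + 18 * cmRoot R) / 28) ^ 2 + ((1 : ℤ) : cmField R) = 0 := by
  have ht := cmRoot_quartic R hR
  push_cast at ht ⊢
  linear_combination (cmRoot R ^ 2 / 784 + 1 / 196) * ht

/-- **`ℚ(i,√15)/ℚ` is Galois.** [folklore] -/
theorem sqrtNeg1Sqrt15_isGalois (hR : R = X ^ 2 + C 32 * X + C 196) [Fact (Irreducible (cmPolyQ R))] :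
    IsGalois ℚ (cmField R) :=
  isGalois_of_sq_add R hR _ (sqrtNeg1Sqrt15_twist_sq hR)

/-- **The rows `W8.ℚ(i,√15).δ`: on EVERY row a CM eightfold with HC in the kernel** (`B⁴`, `B ~ C₁²`, `C₁` an elliptic
curve with CM by `ℚ(i)`). [cite: Gordon1999HodgeAVSurvey, Thm. 6.4] [cite: Deligne1982HodgeCycles, §5 (c) pp. 38–39] -/
theorem sqrtNeg1Sqrt15_carrier_rows_hodgeConjectureFor (hR : R = X ^ 2 + C 32 * X + C 196)
    [Fact (Irreducible (realPolyQ R))] (δ : cmNormResidueGroup R) :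
    ∃ (A : AbelianVariety ℂ) (η : A ⟶ A) (h : complexBetti A.X 2),
      A.dim = 8 ∧ IsOfCMType A ∧ IsWeilTypeCM A η R 2 2 ∧ IsPolarizationClass A.dim A.X h ∧ RosatiCompatible A η h ∧
      HasWeilDiscriminantCM A η R 2 2 h δ ∧ HodgeConjectureFor A.dim A.X ∧
      weilClassesField A η (R.comp (X ^ 2)) (2 * 2) ≤ algebraicClasses A.X 2 := by
  haveI := sqrtNeg1Sqrt15_fact_cmPolyQ hR
  exact carrier_exists_cmEightfold_hodgeConjectureFor_of_sqrt R hR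
    (roots_real_neg_of_quadratic hR (by norm_num) (by norm_num) (by norm_num)) _ (sqrtNeg1Sqrt15_twist_sq hR)
    one_pos _ (sqrtNeg1Sqrt15_sqrtNegOne_sq hR) δ

/-- **All ranks over `ℚ(i,√15)`: rows `W_{4n}.E.δ`, every `n ≥ 1` (`g = 4, 8, 12, …`), every `δ`** — a CM member of
induced type (from `ℚ(i)`), Weil type of `E`-rank `2n`, polarization class of discriminant `δ`, HC in the kernel,
`W_E ⊗ ℂ` algebraic. [cite: Gordon1999HodgeAVSurvey, Thm. 6.4] [cite: Deligne1982HodgeCycles, §5 (c) pp. 38–39] -/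
theorem sqrtNeg1Sqrt15_carrier_allRanks_hodgeConjectureFor (hR : R = X ^ 2 + C 32 * X + C 196)
    [Fact (Irreducible (realPolyQ R))] {n : ℕ} (hn : 0 < n) (δ : cmNormResidueGroup R) :
    ∃ (A : AbelianVariety ℂ) (η : A ⟶ A) (h : complexBetti A.X 2),
      IsOfCMType A ∧ IsWeilTypeCM A η R 2 n ∧ IsPolarizationClass A.dim A.X h ∧ RosatiCompatible A η h ∧
      HasWeilDiscriminantCM A η R 2 n h δ ∧ HodgeConjectureFor A.dim A.X ∧
      weilClassesField A η (R.comp (X ^ 2)) (2 * n) ≤ algebraicClasses A.X n := by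
  haveI := sqrtNeg1Sqrt15_fact_cmPolyQ hR
  exact carrier_exists_cmMember_hodgeConjectureFor_of_sqrt R hR
    (roots_real_neg_of_quadratic hR (by norm_num) (by norm_num) (by norm_num)) _ (sqrtNeg1Sqrt15_twist_sq hR)
    one_pos _ (sqrtNeg1Sqrt15_sqrtNegOne_sq hR) hn δ

end SqrtNeg1Sqrt15

/-! ## §2 `ℚ(√-5,√3)`: `R = S² + 40S + 100` (`η = √-5(1+√3)`), biquadratic, `ℚ(√-5) ⊂ E` -/

section SqrtNeg5Sqrt3

variable {R : Polynomial ℤ}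

/-- The `Fact` for `E = ℚ(√-5,√3) = ℚ[T]/(T⁴ + 40T² + 100)` (discriminant `1200 = 3·20²`). [folklore] -/
theorem sqrtNeg5Sqrt3_fact_cmPolyQ (hR : R = X ^ 2 + C 40 * X + C 100) : Fact (Irreducible (cmPolyQ R)) :=
  fact_irreducible_cmPolyQ_of_pos hR (by norm_num) (by norm_num)
    (not_sq_of_eq_prime_mul_sq (ℓ := 3) Nat.prime_three (m := 20) (by norm_num) (by norm_num))

/-- In `ℚ(√-5,√3)`: `η' = -(η³ + 40η)/10 = 10η⁻¹` satisfies `η'² + η² + 40 = 0`. [folklore] -/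
theorem sqrtNeg5Sqrt3_twist_sq (hR : R = X ^ 2 + C 40 * X + C 100) [Fact (Irreducible (cmPolyQ R))] :
    (-(cmRoot R ^ 3 + 40 * cmRoot R) / 10) ^ 2 + cmRoot R ^ 2 + ((40 : ℤ) : cmField R) = 0 := by
  have ht := cmRoot_quartic R hR
  push_cast at ht ⊢
  linear_combination (cmRoot R ^ 2 / 100 + 2 / 5) * ht

/-- In `ℚ(√-5,√3)`: `i = -(η³ + 30η)/20` satisfies `i² + 5 = 0`. [folklore] -/
theorem sqrtNeg5Sqrt3_sqrtNegFive_sq (hR : R = X ^ 2 + C 40 * X + C 100) [Fact (Irreducible (cmPolyQ R))] :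
    (-(cmRoot R ^ 3 + 30 * cmRoot R) / 20) ^ 2 + ((5 : ℤ) : cmField R) = 0 := by
  have ht := cmRoot_quartic R hR
  push_cast at ht ⊢
  linear_combination (cmRoot R ^ 2 / 400 + 1 / 20) * ht

/-- **`ℚ(√-5,√3)/ℚ` is Galois.** [folklore] -/
theorem sqrtNeg5Sqrt3_isGalois (hR : R = X ^ 2 + C 40 * X + C 100) [Fact (Irreducible (cmPolyQ R))] :
    IsGalois ℚ (cmField R) :=
  isGalois_of_sq_add R hR _ (sqrtNeg5Sqrt3_twist_sq hR)

/-- **The rows `W8.ℚ(√-5,√3).δ`: on EVERY row a CM eightfold with HC in the kernel** (`B⁴`, `B ~ C₁²`, `C₁` an elliptic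
curve with CM by `ℚ(√-5)`). [cite: Gordon1999HodgeAVSurvey, Thm. 6.4] [cite: Deligne1982HodgeCycles, §5 (c) pp. 38–39] -/
theorem sqrtNeg5Sqrt3_carrier_rows_hodgeConjectureFor (hR : R = X ^ 2 + C 40 * X + C 100)
    [Fact (Irreducible (realPolyQ R))] (δ : cmNormResidueGroup R) :
    ∃ (A : AbelianVariety ℂ) (η : A ⟶ A) (h : complexBetti A.X 2),
      A.dim = 8 ∧ IsOfCMType A ∧ IsWeilTypeCM A η R 2 2 ∧ IsPolarizationClass A.dim A.X h ∧ RosatiCompatible A η h ∧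
      HasWeilDiscriminantCM A η R 2 2 h δ ∧ HodgeConjectureFor A.dim A.X ∧
      weilClassesField A η (R.comp (X ^ 2)) (2 * 2) ≤ algebraicClasses A.X 2 := by
  haveI := sqrtNeg5Sqrt3_fact_cmPolyQ hR
  exact carrier_exists_cmEightfold_hodgeConjectureFor_of_sqrt R hR
    (roots_real_neg_of_quadratic hR (by norm_num) (by norm_num) (by norm_num)) _ (sqrtNeg5Sqrt3_twist_sq hR)
    (by norm_num) _ (sqrtNeg5Sqrt3_sqrtNegFive_sq hR) δ

/-- **All ranks over `ℚ(√-5,√3)`: rows `W_{4n}.E.δ`, every `n ≥ 1` (`g = 4, 8, 12, …`), every `δ`** — a CM member of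
induced type (from `ℚ(√-5)`), Weil type of `E`-rank `2n`, polarization class of discriminant `δ`, HC in the kernel,
`W_E ⊗ ℂ` algebraic. [cite: Gordon1999HodgeAVSurvey, Thm. 6.4] [cite: Deligne1982HodgeCycles, §5 (c) pp. 38–39] -/
theorem sqrtNeg5Sqrt3_carrier_allRanks_hodgeConjectureFor (hR : R = X ^ 2 + C 40 * X + C 100)
    [Fact (Irreducible (realPolyQ R))] {n : ℕ} (hn : 0 < n) (δ : cmNormResidueGroup R) :
    ∃ (A : AbelianVariety ℂ) (η : A ⟶ A) (h : complexBetti A.X 2),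
      IsOfCMType A ∧ IsWeilTypeCM A η R 2 n ∧ IsPolarizationClass A.dim A.X h ∧ RosatiCompatible A η h ∧
      HasWeilDiscriminantCM A η R 2 n h δ ∧ HodgeConjectureFor A.dim A.X ∧
      weilClassesField A η (R.comp (X ^ 2)) (2 * n) ≤ algebraicClasses A.X n := by
  haveI := sqrtNeg5Sqrt3_fact_cmPolyQ hR
  exact carrier_exists_cmMember_hodgeConjectureFor_of_sqrt R hR
    (roots_real_neg_of_quadratic hR (by norm_num) (by norm_num) (by norm_num)) _ (sqrtNeg5Sqrt3_twist_sq hR)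
    (by norm_num) _ (sqrtNeg5Sqrt3_sqrtNegFive_sq hR) hn δ

end SqrtNeg5Sqrt3

/-! ## §3 `ℚ(√-3,√-5)`: `R = S² + 16S + 4` (`η = √-3 + √-5`), biquadratic, `ℚ(√-3) ⊂ E` -/

section SqrtNeg3SqrtNeg5

variable {R : Polynomial ℤ}

/-- The `Fact` for `E = ℚ(√-3,√-5) = ℚ[T]/(T⁴ + 16T² + 4)` (discriminant `240 = 15·4²`). [folklore] -/
theorem sqrtNeg3SqrtNeg5_fact_cmPolyQ (hR : R = X ^ 2 + C 16 * X + C 4) : Fact (Irreducible (cmPolyQ R)) :=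
  fact_irreducible_cmPolyQ_of_pos hR (by norm_num) (by norm_num)
    (not_sq_of_eq_nonsquare_mul_sq (n := 15) (not_isSquare_of_sq_lt_of_lt_sq (k := 3) (by norm_num) (by norm_num)) (m := 4)
      (by norm_num) (by norm_num))

/-- In `ℚ(√-3,√-5)`: `η' = -(η³ + 16η)/2 = 2η⁻¹` satisfies `η'² + η² + 16 = 0`. [folklore] -/
theorem sqrtNeg3SqrtNeg5_twist_sq (hR : R = X ^ 2 + C 16 * X + C 4) [Fact (Irreducible (cmPolyQ R))] :
    (-(cmRoot R ^ 3 + 16 * cmRoot R) / 2) ^ 2 + cmRoot R ^ 2 + ((16 : ℤ) : cmField R) = 0 := by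
  have ht := cmRoot_quartic R hR
  push_cast at ht ⊢
  linear_combination (cmRoot R ^ 2 / 4 + 4) * ht

/-- In `ℚ(√-3,√-5)`: `i = -(η³ + 14η)/4` satisfies `i² + 3 = 0`. [folklore] -/
theorem sqrtNeg3SqrtNeg5_sqrtNegThree_sq (hR : R = X ^ 2 + C 16 * X + C 4) [Fact (Irreducible (cmPolyQ R))] :
    (-(cmRoot R ^ 3 + 14 * cmRoot R) / 4) ^ 2 + ((3 : ℤ) : cmField R) = 0 := by
  have ht := cmRoot_quartic R hR
  push_cast at ht ⊢
  linear_combination (cmRoot R ^ 2 / 16 + 3 / 4) * ht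

/-- **`ℚ(√-3,√-5)/ℚ` is Galois.** [folklore] -/
theorem sqrtNeg3SqrtNeg5_isGalois (hR : R = X ^ 2 + C 16 * X + C 4) [Fact (Irreducible (cmPolyQ R))] :
    IsGalois ℚ (cmField R) :=
  isGalois_of_sq_add R hR _ (sqrtNeg3SqrtNeg5_twist_sq hR)

/-- **The rows `W8.ℚ(√-3,√-5).δ`: on EVERY row a CM eightfold with HC in the kernel** (`B⁴`, `B ~ C₁²`, `C₁` an elliptic
curve with CM by `ℚ(√-3)`). [cite: Gordon1999HodgeAVSurvey, Thm. 6.4] [cite: Deligne1982HodgeCycles, §5 (c) pp. 38–39] -/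
theorem sqrtNeg3SqrtNeg5_carrier_rows_hodgeConjectureFor (hR : R = X ^ 2 + C 16 * X + C 4)
    [Fact (Irreducible (realPolyQ R))] (δ : cmNormResidueGroup R) :
    ∃ (A : AbelianVariety ℂ) (η : A ⟶ A) (h : complexBetti A.X 2),
      A.dim = 8 ∧ IsOfCMType A ∧ IsWeilTypeCM A η R 2 2 ∧ IsPolarizationClass A.dim A.X h ∧ RosatiCompatible A η h ∧
      HasWeilDiscriminantCM A η R 2 2 h δ ∧ HodgeConjectureFor A.dim A.X ∧
      weilClassesField A η (R.comp (X ^ 2)) (2 * 2) ≤ algebraicClasses A.X 2 := by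
  haveI := sqrtNeg3SqrtNeg5_fact_cmPolyQ hR
  exact carrier_exists_cmEightfold_hodgeConjectureFor_of_sqrt R hR
    (roots_real_neg_of_quadratic hR (by norm_num) (by norm_num) (by norm_num)) _ (sqrtNeg3SqrtNeg5_twist_sq hR)
    (by norm_num) _ (sqrtNeg3SqrtNeg5_sqrtNegThree_sq hR) δ

/-- **All ranks over `ℚ(√-3,√-5)`: rows `W_{4n}.E.δ`, every `n ≥ 1` (`g = 4, 8, 12, …`), every `δ`** — a CM member of
induced type (from `ℚ(√-3)`), Weil type of `E`-rank `2n`, polarization class of discriminant `δ`, HC in the kernel,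
`W_E ⊗ ℂ` algebraic. [cite: Gordon1999HodgeAVSurvey, Thm. 6.4] [cite: Deligne1982HodgeCycles, §5 (c) pp. 38–39] -/
theorem sqrtNeg3SqrtNeg5_carrier_allRanks_hodgeConjectureFor (hR : R = X ^ 2 + C 16 * X + C 4)
    [Fact (Irreducible (realPolyQ R))] {n : ℕ} (hn : 0 < n) (δ : cmNormResidueGroup R) :
    ∃ (A : AbelianVariety ℂ) (η : A ⟶ A) (h : complexBetti A.X 2),
      IsOfCMType A ∧ IsWeilTypeCM A η R 2 n ∧ IsPolarizationClass A.dim A.X h ∧ RosatiCompatible A η h ∧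
      HasWeilDiscriminantCM A η R 2 n h δ ∧ HodgeConjectureFor A.dim A.X ∧
      weilClassesField A η (R.comp (X ^ 2)) (2 * n) ≤ algebraicClasses A.X n := by
  haveI := sqrtNeg3SqrtNeg5_fact_cmPolyQ hR
  exact carrier_exists_cmMember_hodgeConjectureFor_of_sqrt R hR
    (roots_real_neg_of_quadratic hR (by norm_num) (by norm_num) (by norm_num)) _ (sqrtNeg3SqrtNeg5_twist_sq hR)
    (by norm_num) _ (sqrtNeg3SqrtNeg5_sqrtNegThree_sq hR) hn δ

end SqrtNeg3SqrtNeg5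

/-! ## §4 `ℚ(√-3(5+√5)/2)`: `R = S² + 15S + 45` (`η² = -3(5+√5)/2 = 3(ζ₅ - ζ₅⁻¹)²`), CYCLIC (conductor 60) -/

section SqrtNegThreeTimesFivePlusSqrtFiveHalf

variable {R : Polynomial ℤ}

/-- The `Fact` for `E = ℚ(√-3(5+√5)/2) = ℚ[T]/(T⁴ + 15T² + 45)` (discriminant `45 = 5·3²`). [folklore] -/
theorem sqrtNegThreeTimesFivePlusSqrtFiveHalf_fact_cmPolyQ (hR : R = X ^ 2 + C 15 * X + C 45) : Fact (Irreducible (cmPolyQ R)) :=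
  fact_irreducible_cmPolyQ_of_pos hR (by norm_num) (by norm_num)
    (not_sq_of_eq_prime_mul_sq (ℓ := 5) Nat.prime_five (m := 3) (by norm_num) (by norm_num))

/-- In `ℚ(√-3(5+√5)/2)`: `η' = (η³ + 9η)/3` satisfies `η'² + η² + 15 = 0` (`η η'` is `3√5 = -(2η² + 15)`). [folklore] -/
theorem sqrtNegThreeTimesFivePlusSqrtFiveHalf_twist_sq (hR : R = X ^ 2 + C 15 * X + C 45) [Fact (Irreducible (cmPolyQ R))] :
    ((cmRoot R ^ 3 + 9 * cmRoot R) / 3) ^ 2 + cmRoot R ^ 2 + ((15 : ℤ) : cmField R) = 0 := by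
  have ht := cmRoot_quartic R hR
  push_cast at ht ⊢
  linear_combination (cmRoot R ^ 2 / 9 + 1 / 3) * ht

/-- **`ℚ(√-3(5+√5)/2)/ℚ` is Galois.** [folklore] -/
theorem sqrtNegThreeTimesFivePlusSqrtFiveHalf_isGalois (hR : R = X ^ 2 + C 15 * X + C 45) [Fact (Irreducible (cmPolyQ R))] :
    IsGalois ℚ (cmField R) :=
  isGalois_of_sq_add R hR _ (sqrtNegThreeTimesFivePlusSqrtFiveHalf_twist_sq hR)

/-- **`Gal(ℚ(√-3(5+√5)/2)/ℚ)` is cyclic** (`σ : η ↦ (η³ + 9η)/3`, `σ²(η) = -η`). [folklore] -/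
theorem sqrtNegThreeTimesFivePlusSqrtFiveHalf_isCyclic (hR : R = X ^ 2 + C 15 * X + C 45) [Fact (Irreducible (cmPolyQ R))] :
    IsCyclic (cmField R ≃ₐ[ℚ] cmField R) := by
  have ht := cmRoot_quartic R hR
  push_cast at ht
  refine isCyclic_of_sq_add R hR _ (sqrtNegThreeTimesFivePlusSqrtFiveHalf_twist_sq hR) (C (1 / 3 : ℚ) * (X ^ 3 + 9 * X)) ?_ ?_
  · simp only [map_add, map_mul, map_pow, aeval_X, aeval_C, map_div₀, map_one, map_ofNat]
    ring
  · simp only [map_add, map_mul, map_pow, aeval_X, aeval_C, map_div₀, map_one, map_ofNat]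
    linear_combination (cmRoot R ^ 5 / 81 + 4 / 27 * cmRoot R ^ 3 + 2 / 9 * cmRoot R) * ht

/-- **The rows `W8.ℚ(√-3(5+√5)/2).δ`: on EVERY row a CM eightfold with HC in the kernel** (`A ≅ B⁴`, `B` a SIMPLE CM
surface). [cite: Pohlmann1968, Thm. 1] [cite: Deligne1982HodgeCycles, §5 (c) pp. 38–39] -/
theorem sqrtNegThreeTimesFivePlusSqrtFiveHalf_carrier_rows_hodgeConjectureFor (hR : R = X ^ 2 + C 15 * X + C 45)
    [Fact (Irreducible (realPolyQ R))] (δ : cmNormResidueGroup R) :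
    ∃ (A : AbelianVariety ℂ) (η : A ⟶ A) (h : complexBetti A.X 2) (B : AbelianVariety ℂ),
      Nonempty (A ≅ ⨁ fun _ : Fin 4 => B) ∧ B.IsSimple ∧ B.dim = 2 ∧ IsOfCMType B ∧ A.dim = 8 ∧ IsOfCMType A ∧
      IsWeilTypeCM A η R 2 2 ∧ IsPolarizationClass A.dim A.X h ∧ RosatiCompatible A η h ∧
      HasWeilDiscriminantCM A η R 2 2 h δ ∧ HodgeConjectureFor A.dim A.X ∧
      weilClassesField A η (R.comp (X ^ 2)) (2 * 2) ≤ algebraicClasses A.X 2 := by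
  haveI := sqrtNegThreeTimesFivePlusSqrtFiveHalf_fact_cmPolyQ hR
  have hroots := roots_real_neg_of_quadratic hR (by norm_num) (by norm_num) (by norm_num)
  haveI : IsCMField (cmField R) := isCMField_cmField hroots
  haveI := sqrtNegThreeTimesFivePlusSqrtFiveHalf_isGalois hR
  obtain ⟨hRm, hRdeg⟩ := monic_and_natDegree_of_quadratic R hR
  exact carrier_exists_cmEightfold_hodgeConjectureFor_of_isCyclic R hRm hRdeg hroots
    (sqrtNegThreeTimesFivePlusSqrtFiveHalf_isCyclic hR) δ

/-- **All ranks over `ℚ(√-3(5+√5)/2)`: rows `W_{4n}.E.δ`, every `n ≥ 1`, every `δ`:** `B^{2n}`, `B` a SIMPLE CM surface,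
Weil type of `E`-rank `2n`, polarization class of discriminant `δ`, HC in the kernel, `W_E ⊗ ℂ` algebraic.
[cite: Pohlmann1968, Thm. 1] [cite: Deligne1982HodgeCycles, §5 (c) pp. 38–39] -/
theorem sqrtNegThreeTimesFivePlusSqrtFiveHalf_carrier_allRanks_hodgeConjectureFor (hR : R = X ^ 2 + C 15 * X + C 45)
    [Fact (Irreducible (realPolyQ R))] {n : ℕ} (hn : 0 < n) (δ : cmNormResidueGroup R) :
    ∃ (B : AbelianVariety ℂ) (η : (⨁ fun _ : Fin (2 * n) => B) ⟶ ⨁ fun _ : Fin (2 * n) => B)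
      (h : complexBetti (⨁ fun _ : Fin (2 * n) => B).X 2),
      B.IsSimple ∧ B.dim = 2 ∧ IsOfCMType B ∧
      IsOfCMType (⨁ fun _ : Fin (2 * n) => B) ∧ IsWeilTypeCM (⨁ fun _ : Fin (2 * n) => B) η R 2 n ∧
      IsPolarizationClass (⨁ fun _ : Fin (2 * n) => B).dim (⨁ fun _ : Fin (2 * n) => B).X h ∧
      RosatiCompatible (⨁ fun _ : Fin (2 * n) => B) η h ∧
      HasWeilDiscriminantCM (⨁ fun _ : Fin (2 * n) => B) η R 2 n h δ ∧
      HodgeConjectureFor (⨁ fun _ : Fin (2 * n) => B).dim (⨁ fun _ : Fin (2 * n) => B).X ∧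
      weilClassesField (⨁ fun _ : Fin (2 * n) => B) η (R.comp (X ^ 2)) (2 * n) ≤
        algebraicClasses (⨁ fun _ : Fin (2 * n) => B).X n := by
  haveI := sqrtNegThreeTimesFivePlusSqrtFiveHalf_fact_cmPolyQ hR
  have hroots := roots_real_neg_of_quadratic hR (by norm_num) (by norm_num) (by norm_num)
  haveI : IsCMField (cmField R) := isCMField_cmField hroots
  haveI := sqrtNegThreeTimesFivePlusSqrtFiveHalf_isGalois hR
  obtain ⟨hRm, hRdeg⟩ := monic_and_natDegree_of_quadratic R hR
  exact carrier_exists_simplePower_hodgeConjectureFor_of_isCyclic R hRm hRdeg le_rfl hroots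
    (sqrtNegThreeTimesFivePlusSqrtFiveHalf_isCyclic hR) hn δ

end SqrtNegThreeTimesFivePlusSqrtFiveHalf

end Summit.HodgeConjecture.HodgeConjecture.Ring2.WeilCoverageCM

end
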